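import Literature.MathematicalPhysics.QuantumFieldTheory.Balaban1983to89.B9Eq3104CutoffCommutators
import Literature.MathematicalPhysics.QuantumFieldTheory.Balaban1983to89.B9CubeLettersBondOpsL0
import Literature.MathematicalPhysics.QuantumFieldTheory.Balaban1983to89.B9Eq3105Sum

/-!
# `Balaban1983to89.B9Eq3105AtLetters` — T. Bałaban, *Propagators for lattice gauge theories in a background field*, Commun. Math. Phys. **99** (1985)
# 389–434 [Balaban1985BackgroundPropagators], (3.105) p. 414 «Δ_aG₀ = I − R» AT def-Y's GENUINE LETTERS: b09's abstract ring identity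
# `B9Eq3105Sum.eq3105_sum` instantiated in `End_ℂ(FBondY i → 𝔸)` at `Δ_a(U)`, the partition of record `h_□ = hT`, ANY cut-offs `ζ_□̃ = 1 on supp h_□`,
# and r05's cube letters `G_□(U) = Δ_{a,□}(U)⁻¹`, `R_□(U)` (sub-row G-B9-LETTERS, module M5.7 «(3.105) assembly»; the first identity of
# `B9Thm310Whole.Identities310` at the cube cover of record)

statement-level skeleton of published theorems with citation tags; proofs where landed; nothing here is a claim about the Yang–Mills mass gap

PDF held: `paper:balaban1985-cmp99-background-propagators` (journal page = PDF page + 388); pp. 409, 413–414 read from the held text layer.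
p. 414: «Applying this formula to Δ_aG₀ we get Δ_aG₀ = I − Σ_□K(h_□)G_□h_□ − Σ_□(1 − ζ_□̃)DPD*h_□G_□h_□ − Σ_□ζ_□̃(DPD* − DP_□D*)h_□G_□h_□
− Σ_□ζ_□̃P_{□,1}(∂h_□)G_□h_□ = I − R. (3.105)»; (3.104) p. 414 «Δ_a hA = hΔ_a − K(h)A − P₁(∂h)A»; (3.101) p. 414 «(DPD*hA)_μ(x) = h(x)(DPD*A)_μ(x) +
(P₁(∂h)A)_μ(x)»; p. 414 «DRD* = DD* − DPD*»; (3.87) p. 409 «G₀ = Σ_{□∈𝒟} h_□G_□h_□»; p. 408 «Σ_□ h_□² = 1»; p. 409 l.3–5 «The operators constructed for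
this sequence, which we denote by G′_□(U), C_□(U) = (Q(U)G′_□²(U)Q*(U))⁻¹, G_□(U), satisfy all the inequalities of Theorems 3.1–3.3 correspondingly».

WHAT THIS FILE IS.  b09's `B9Eq3105Sum` kernel-checks (3.105) in ANY ring from five displayed relations (h104, h101, hζ, hloc, hpu); A′
(`B9Eq3104CutoffCommutators`) has the letters `Δ_loc(U)`, `DPD*(U)`, `K(h)(U)`, `P₁(∂h)(U)` of (3.101)∕(3.104) at def-Y's `Δ_a(U) = deltaAY`, and
«Δ_a = Δ_loc − DPD*»; r05's `B9CubeLettersBondOpsL0` has the cube letters `Δ_{a,□}(U)`, `G_□(U) = Δ_{a,□}(U)⁻¹`, `R_□(U)`; the partition of record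
`h_□ = hTY i □` has «Σ h_□² = 1» as `sum_cutMulY_hT_mul_self`.  THIS FILE assembles them: §1 the local projection letters `DP_□D*(U)`
(`DPDsCubeY`), `P_{□,1}(∂h)(U)` (`P1CubeY`), the P-free part `Δ_{loc,□}(U)` (`deltaLocCubeY`) with «Δ_{a,□} = Δ_{loc,□} − DP_□D*» and (3.101) for
`P_□`; §2 ★ `eq3105_deltaAY` — (3.105) for ANY real family `hf` with `Σ hf² = 1`, ANY cut-offs `ζ` equal to `1` on `supp hf_□`, ANY cube operators
`Gl □` and local projection letters, under the local-inverse relation `hloc` (displayed, as in the site-sector twin `B9Thm37CubeCoverCommutators.eq388_hT`),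
and the fixed point `G = G₀ + G·R` for any left inverse `G` of `Δ_a(U)` (`fixedPoint3105_deltaAY`); §3 ★★ `eq3105_hT_GACubeY` — AT THE PARTITION OF RECORD
AND r05's `G_□(U)`: `hloc` DISCHARGED from the invertibility of `Δ_{a,□}(U)` and a displayed ROWS-AGREEMENT hypothesis on `supp h_□` (the averaging rows
of `Δ_{a,□}(U)` and `Δ_a(U)` coincide where `h_□ ≠ 0` — r05's `B9CubeBondRowAgreement.QsaQCubeY_apply_eq_of_nearH` with the `NearH` bookkeeping of
`supp h_□`, not repeated here), + `fixedPoint3105_hT_GACubeY`.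
HONEST SCOPE.  Pure algebra: an identity, no estimate; `ζ_□̃` is ANY family with `ζ_□̃ = 1` on `supp h_□` (print's specific `ζ_□̃` of p. 414 is one);
the invertibility of `Δ_{a,□}(U)` (Thm 3.3's regime for the cube sequence) and the rows agreement are HYPOTHESES; the smallness of the four families of `R`
(p. 414, GAPS G-B9-05∕06a∕07) is NOT touched (the first family is E′₂b∕E′₃∕E′₄ of this seat); `G = G₀(I − R)⁻¹` (3.106) needs `‖R‖ < 1` and is the glue's
(`B9Eq3105Sum.eq3106_*`); nothing continuum ∕ OS ∕ mass gap ∕ Clay; YM mass gap NOT proved by any of this (Track A conditional rung).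
`--supports stmt-QuantumFields-19200`.  Net new unproved facts: 0 (three real `def`s, theorems).
-/

noncomputable section

namespace Literature.MathematicalPhysics.QuantumFieldTheory.Balaban1983to89.B9Eq3105AtLetters

open Node00
open B9Thm37CubeCoverCommutators (cutMulY cutMulY_apply cutCommY mul_cutMulY_eq hTY hTY_apply sum_hTY_sq sum_cutMulY_mul_self
  sum_cutMulY_hT_mul_self)
open B9Eq3104CutoffCommutators (cutCommR cutCommR_apply comp_cutMulY_eq_sub hBdY hBdY_apply deltaLocY DPDsY KhBY P1Y deltaAY_eq_loc_sub)
open B9CubeLettersBondOpsL0 (RCubeY QCubeY QsCubeY aCubeY deltaACubeY GACubeY deltaACubeY_mul_GACubeY)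
open B9Eq3105Sum (eq3105_sum eq3105_oneSub hloc_of_localInverse fixedPoint_of_3105)
open B6KLevelCensusIndexV1 (KIdx)
open B6Cover236MultiLevelBlocks (cubes)
open Node00.OpsYNablaBridge (chartY)
open scoped Matrix

variable {d ℓ : ℕ} {hd : 1 ≤ d + 1} {hL : Odd (ℓ + 1) ∧ 1 < ℓ + 1} {b₀ b₁ : ℝ}
variable {𝔸 : Type} [NormedRing 𝔸] [NormedAlgebra ℂ 𝔸] [CompleteSpace 𝔸]
variable (i : KIdx d ℓ hd hL b₀ b₁)

/-! ## §1 The local projection letters of the cube sequence: `DP_□D*(U)`, `P_{□,1}(∂h)(U)`, `Δ_{loc,□}(U)` -/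

section CubeLetters

variable (q : ↥(cubes i.D.toDomains))

/-- **`D_U P_□(U) D*_U`**, `P_□ = 1 − R_□` — the nonlocal part of `Δ_{a,□}(U)` (the `DP_□D*` of (3.105)).
[cite: Balaban1985BackgroundPropagators, (3.105) p.414, (3.25)–(3.26) p.395, p.409 l.1–5] -/
def DPDsCubeY (parS : SiteParY 𝔸 i) (U : CfgY 𝔸 i) : (FBondY i → 𝔸) →ₗ[ℂ] (FBondY i → 𝔸) :=
  gradY i U ∘ₗ (LinearMap.id - RCubeY i q parS U) ∘ₗ divY i U

/-- **`P_{□,1}(∂h)(U) := DP_□D*·h − h·DP_□D*`** — (3.101) for the cube sequence's projection. [cite: Balaban1985BackgroundPropagators, (3.101) p.414, (3.105) p.414] -/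
def P1CubeY (h : SiteY i → ℝ) (parS : SiteParY 𝔸 i) (U : CfgY 𝔸 i) : (FBondY i → 𝔸) →ₗ[ℂ] (FBondY i → 𝔸) :=
  -cutCommR (hBdY i h) (hBdY i h) (DPDsCubeY i q parS U)

/-- **the P-free (local) part of `Δ_{a,□}(U)`**: `Δ_{loc,□}(U) := Δ(U) + D_U D*_U + Q*_□(U) a_□ Q_□(U)`. [cite: Balaban1985BackgroundPropagators, (3.26) p.395, p.409 l.1–5, p.414 («DRD* = DD* − DPD*»)] -/
def deltaLocCubeY (parB : BondParY 𝔸 i) (U : CfgY 𝔸 i) : (FBondY i → 𝔸) →ₗ[ℂ] (FBondY i → 𝔸) :=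
  hessY i U + gradY i U ∘ₗ divY i U + QsCubeY i q parB U ∘ₗ aCubeY i q ∘ₗ QCubeY i q parB U

/-- ★ `Δ_{a,□}(U) = Δ_{loc,□}(U) − D_U P_□(U) D*_U` («DRD* = DD* − DPD*» for the cube sequence). [cite: Balaban1985BackgroundPropagators, (3.26) p.395, p.414] -/
theorem deltaACubeY_eq_loc_sub (parS : SiteParY 𝔸 i) (parB : BondParY 𝔸 i) (U : CfgY 𝔸 i) :
    deltaACubeY i q parS parB U = deltaLocCubeY i q parB U - DPDsCubeY i q parS U := by
  simp only [deltaACubeY, deltaLocCubeY, DPDsCubeY, LinearMap.comp_sub, LinearMap.sub_comp, LinearMap.id_comp]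
  abel

/-- (3.101) for `P_□` as an operator identity: `DP_□D* · (h·) = (h·) · DP_□D* + P_{□,1}(∂h)`. [cite: Balaban1985BackgroundPropagators, (3.101) p.414] -/
theorem DPDsCubeY_mul_cutMulY (h : SiteY i → ℝ) (parS : SiteParY 𝔸 i) (U : CfgY 𝔸 i) :
    DPDsCubeY i q parS U * cutMulY (hBdY i h) = cutMulY (hBdY i h) * DPDsCubeY i q parS U + P1CubeY i q h parS U := by
  rw [P1CubeY, ← sub_eq_add_neg]
  exact comp_cutMulY_eq_sub (hBdY i h) (hBdY i h) (DPDsCubeY i q parS U)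

end CubeLetters

/-! ## §2 (3.105) at `Δ_a(U)` for any partition family, any cut-offs `ζ = 1 on supp h`, any cube operators with the local-inverse relation -/

section Generic

/-- (3.104), P-free part, at def-Y's letters: `Δ_loc(U)·(h·) = (h·)·Δ_loc(U) − K(h)(U)`. [cite: Balaban1985BackgroundPropagators, (3.104) p.414] -/
theorem deltaLocY_mul_cutMulY (h : SiteY i → ℝ) (parB : BondParY 𝔸 i) (U : CfgY 𝔸 i) :
    deltaLocY i parB U * cutMulY (hBdY i h) = cutMulY (hBdY i h) * deltaLocY i parB U - KhBY i h parB U :=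
  comp_cutMulY_eq_sub (hBdY i h) (hBdY i h) (deltaLocY i parB U)

omit [CompleteSpace 𝔸] in
/-- `ζ·h = h` as operators when `ζ = 1` wherever `h ≠ 0` («Using the fact that ζ_□̃h_□ = h_□», p. 415). [cite: Balaban1985BackgroundPropagators, p.415, (3.105) p.414] -/
theorem cutMulY_mul_cutMulY_of_eq_one {X : Type} (ζ h : X → ℝ) (hζ : ∀ x, h x ≠ 0 → ζ x = 1) :
    cutMulY (𝔸 := 𝔸) ζ * cutMulY h = cutMulY h := by
  refine LinearMap.ext fun Λ => funext fun x => ?_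
  rw [Module.End.mul_apply, cutMulY_apply, cutMulY_apply, smul_smul, ← Complex.ofReal_mul]
  by_cases hx : h x = 0
  · rw [hx, mul_zero]
  · rw [hζ x hx, one_mul]

/-- ★ **(3.105) AT `Δ_a(U)`, GENERIC FORM**: for ANY real family `hf` with `Σ_□ hf_□² = 1` (read on bonds at `b₋`), ANY cut-offs `ζ_□` with `ζ_□ = 1`
wherever `hf_□ ≠ 0`, ANY cube operators `Gl □` and local projection letters `Pl □` obeying the LOCAL-INVERSE relation
`h_□·(Δ_loc − Pl_□)·Gl_□·h_□ = h_□·h_□` (displayed; print: `G_□ = (Δ_{loc,□} − DP_□D*)⁻¹` and the rows of `Δ_loc`, `Δ_{loc,□}` agree on `supp h_□`):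
`Δ_a(U) · Σ_□ h_□Gl_□h_□ = 1 − Σ_□K(h_□)(U)Gl_□h_□ − Σ_□(1 − ζ_□)DPD*(U)(h_□Gl_□h_□) − Σ_□ζ_□(DPD*(U) − Pl_□)(h_□Gl_□h_□) − Σ_□ζ_□P_{l,1}(∂h_□)Gl_□h_□` with
`P_{l,1}(∂h_□) := Pl_□·h_□ − h_□·Pl_□`. [cite: Balaban1985BackgroundPropagators, (3.105) p.414, (3.104) p.414, (3.101) p.414, (3.87) p.409, p.408 («Σ h_□² = 1»)] -/
theorem eq3105_deltaAY (parS : SiteParY 𝔸 i) (parB : BondParY 𝔸 i) (Gp : SiteOpY 𝔸 i) (U : CfgY 𝔸 i) {κ : Type} [Fintype κ]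
    (hf : κ → SiteY i → ℝ) (hsq : ∀ z, ∑ c, hf c z ^ 2 = 1) (ζ : κ → SiteY i → ℝ) (hζ : ∀ c z, hf c z ≠ 0 → ζ c z = 1)
    (Gl Pl : κ → Module.End ℂ (FBondY i → 𝔸))
    (hloc : ∀ c, cutMulY (hBdY i (hf c)) * (deltaLocY i parB U - Pl c) * Gl c * cutMulY (hBdY i (hf c)) =
      cutMulY (hBdY i (hf c)) * cutMulY (hBdY i (hf c))) :
    deltaAY i parS parB Gp U * ∑ c, cutMulY (hBdY i (hf c)) * Gl c * cutMulY (hBdY i (hf c)) =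
      1 - ∑ c, KhBY i (hf c) parB U * Gl c * cutMulY (hBdY i (hf c))
        - ∑ c, (1 - cutMulY (hBdY i (ζ c))) * DPDsY i parS Gp U * (cutMulY (hBdY i (hf c)) * Gl c * cutMulY (hBdY i (hf c)))
        - ∑ c, cutMulY (hBdY i (ζ c)) * (DPDsY i parS Gp U - Pl c) * (cutMulY (hBdY i (hf c)) * Gl c * cutMulY (hBdY i (hf c)))
        - ∑ c, cutMulY (hBdY i (ζ c)) * -cutCommR (hBdY i (hf c)) (hBdY i (hf c)) (Pl c) * Gl c * cutMulY (hBdY i (hf c)) := by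
  rw [deltaAY_eq_loc_sub]
  refine eq3105_sum (deltaLocY i parB U) (DPDsY i parS Gp U) (fun c => cutMulY (hBdY i (hf c))) (fun c => cutMulY (hBdY i (ζ c)))
    Gl (fun c => KhBY i (hf c) parB U) Pl (fun c => -cutCommR (hBdY i (hf c)) (hBdY i (hf c)) (Pl c))
    (fun c => deltaLocY_mul_cutMulY i (hf c) parB U) (fun c => ?_) (fun c => ?_) hloc ?_
  · rw [← sub_eq_add_neg]
    exact comp_cutMulY_eq_sub (hBdY i (hf c)) (hBdY i (hf c)) (Pl c)
  · exact cutMulY_mul_cutMulY_of_eq_one (hBdY i (ζ c)) (hBdY i (hf c)) fun b hb => hζ c (chartY i b.src) hb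
  · exact sum_cutMulY_mul_self (fun c => hBdY i (hf c)) fun b => hsq (chartY i b.src)

/-- ★ the FIXED POINT `G = G₀ + G·R` for ANY left inverse `G` of `Δ_a(U)` (the form the estimates consume; «G = G₀(I − R)⁻¹» (3.106) read without inverting).
[cite: Balaban1985BackgroundPropagators, (3.105)–(3.106) p.414] -/
theorem fixedPoint3105_deltaAY (parS : SiteParY 𝔸 i) (parB : BondParY 𝔸 i) (Gp : SiteOpY 𝔸 i) (U : CfgY 𝔸 i) {κ : Type} [Fintype κ]
    (hf : κ → SiteY i → ℝ) (hsq : ∀ z, ∑ c, hf c z ^ 2 = 1) (ζ : κ → SiteY i → ℝ) (hζ : ∀ c z, hf c z ≠ 0 → ζ c z = 1)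
    (Gl Pl : κ → Module.End ℂ (FBondY i → 𝔸))
    (hloc : ∀ c, cutMulY (hBdY i (hf c)) * (deltaLocY i parB U - Pl c) * Gl c * cutMulY (hBdY i (hf c)) =
      cutMulY (hBdY i (hf c)) * cutMulY (hBdY i (hf c)))
    {G : Module.End ℂ (FBondY i → 𝔸)} (hG : G * deltaAY i parS parB Gp U = 1) :
    G = (∑ c, cutMulY (hBdY i (hf c)) * Gl c * cutMulY (hBdY i (hf c)))
      + G * (∑ c, KhBY i (hf c) parB U * Gl c * cutMulY (hBdY i (hf c))
        + ∑ c, (1 - cutMulY (hBdY i (ζ c))) * DPDsY i parS Gp U * (cutMulY (hBdY i (hf c)) * Gl c * cutMulY (hBdY i (hf c)))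
        + ∑ c, cutMulY (hBdY i (ζ c)) * (DPDsY i parS Gp U - Pl c) * (cutMulY (hBdY i (hf c)) * Gl c * cutMulY (hBdY i (hf c)))
        + ∑ c, cutMulY (hBdY i (ζ c)) * -cutCommR (hBdY i (hf c)) (hBdY i (hf c)) (Pl c) * Gl c * cutMulY (hBdY i (hf c))) := by
  refine fixedPoint_of_3105 hG ?_
  rw [eq3105_deltaAY i parS parB Gp U hf hsq ζ hζ Gl Pl hloc]
  abel

end Generic

/-! ## §3 (3.105) at the partition of record `h_□ = hT` and r05's cube letters `G_□(U) = Δ_{a,□}(U)⁻¹`, `DP_□D*(U)` -/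

section Record

/-- the local-inverse relation DISCHARGED: if `Δ_{a,□}(U)` is invertible and the averaging rows of `Δ_{a,□}(U)` and `Δ_a(U)` agree wherever `h ≠ 0`, then
`h·(Δ_loc(U) − DP_□D*(U))·G_□(U)·h = h·h`. [cite: Balaban1985BackgroundPropagators, (3.87) p.409, p.409 l.1–5, (3.105) p.414] -/
theorem hloc_GACubeY (q : ↥(cubes i.D.toDomains)) (parS : SiteParY 𝔸 i) (parB : BondParY 𝔸 i) (U : CfgY 𝔸 i) (h : SiteY i → ℝ)
    (hinv : IsUnit (deltaACubeY i q parS parB U))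
    (hrow : ∀ (A : FBondY i → 𝔸) (f : FBondY i), h (chartY i f.src) ≠ 0 →
      QsCubeY i q parB U (aCubeY i q (QCubeY i q parB U A)) f = QsY i parB U (aY i (QY i parB U A)) f) :
    cutMulY (hBdY i h) * (deltaLocY i parB U - DPDsCubeY i q parS U) * GACubeY i q parS parB U * cutMulY (hBdY i h) =
      cutMulY (hBdY i h) * cutMulY (hBdY i h) := by
  refine hloc_of_localInverse (Λl := deltaLocCubeY i q parB U) ?_ ?_
  · rw [← deltaACubeY_eq_loc_sub]
    exact deltaACubeY_mul_GACubeY i q hinv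
  · refine LinearMap.ext fun A => funext fun f => ?_
    rw [Module.End.mul_apply, Module.End.mul_apply, cutMulY_apply, cutMulY_apply, hBdY_apply]
    by_cases hh : h (chartY i f.src) = 0
    · rw [hh, Complex.ofReal_zero, zero_smul, zero_smul]
    · congr 1
      simp only [deltaLocY, deltaLocCubeY, LinearMap.add_apply, Pi.add_apply, LinearMap.comp_apply]
      rw [hrow A f hh]

/-- ★★ **(3.105) AT THE PARTITION OF RECORD AND THE CUBE LETTERS**: with `h_□ = hTY i □`, `G_□(U) = GACubeY i □ parS parB U`, `DP_□D*(U) = DPDsCubeY i □ parS U`,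
`P_{□,1}(∂h_□)(U) = P1CubeY i □ (hTY i □) parS U`, ANY cut-offs `ζ_□̃` with `ζ_□̃ = 1` on `supp h_□`, every `Δ_{a,□}(U)` invertible and the averaging rows of
`Δ_{a,□}(U)`, `Δ_a(U)` agreeing on `supp h_□`:
`Δ_a(U)·Σ_□ h_□G_□(U)h_□ = 1 − Σ_□K(h_□)(U)G_□(U)h_□ − Σ_□(1 − ζ_□̃)DPD*(U)(h_□G_□(U)h_□) − Σ_□ζ_□̃(DPD*(U) − DP_□D*(U))(h_□G_□(U)h_□) − Σ_□ζ_□̃P_{□,1}(∂h_□)(U)G_□(U)h_□`.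
[cite: Balaban1985BackgroundPropagators, (3.105) p.414, (3.87) p.409, p.408 («Σ h_□² = 1»), p.409 l.1–5] -/
theorem eq3105_hT_GACubeY (parS : SiteParY 𝔸 i) (parB : BondParY 𝔸 i) (Gp : SiteOpY 𝔸 i) (U : CfgY 𝔸 i)
    (ζ : ↥(cubes i.D.toDomains) → SiteY i → ℝ) (hζ : ∀ c z, hTY i c z ≠ 0 → ζ c z = 1)
    (hinv : ∀ c : ↥(cubes i.D.toDomains), IsUnit (deltaACubeY i c parS parB U))
    (hrow : ∀ (c : ↥(cubes i.D.toDomains)) (A : FBondY i → 𝔸) (f : FBondY i), hTY i c (chartY i f.src) ≠ 0 →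
      QsCubeY i c parB U (aCubeY i c (QCubeY i c parB U A)) f = QsY i parB U (aY i (QY i parB U A)) f) :
    deltaAY i parS parB Gp U * ∑ c, cutMulY (hBdY i (hTY i c)) * GACubeY i c parS parB U * cutMulY (hBdY i (hTY i c)) =
      1 - ∑ c, KhBY i (hTY i c) parB U * GACubeY i c parS parB U * cutMulY (hBdY i (hTY i c))
        - ∑ c, (1 - cutMulY (hBdY i (ζ c))) * DPDsY i parS Gp U *
            (cutMulY (hBdY i (hTY i c)) * GACubeY i c parS parB U * cutMulY (hBdY i (hTY i c)))
        - ∑ c, cutMulY (hBdY i (ζ c)) * (DPDsY i parS Gp U - DPDsCubeY i c parS U) *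
            (cutMulY (hBdY i (hTY i c)) * GACubeY i c parS parB U * cutMulY (hBdY i (hTY i c)))
        - ∑ c, cutMulY (hBdY i (ζ c)) * P1CubeY i c (hTY i c) parS U * GACubeY i c parS parB U * cutMulY (hBdY i (hTY i c)) :=
  eq3105_deltaAY i parS parB Gp U (hTY i) (sum_hTY_sq i) ζ hζ (fun c => GACubeY i c parS parB U) (fun c => DPDsCubeY i c parS U)
    fun c => hloc_GACubeY i c parS parB U (hTY i c) (hinv c) (hrow c)

/-- ★ the fixed point at the partition of record: ANY left inverse `G` of `Δ_a(U)` (def-Y's `G(U) = Δ_a(U)⁻¹` in Thm 3.3's regime) equals `G₀ + G·R` with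
print's `G₀ = Σ_□ h_□G_□(U)h_□` and `R` the four sums of (3.105). [cite: Balaban1985BackgroundPropagators, (3.105)–(3.106) p.414, (3.87) p.409] -/
theorem fixedPoint3105_hT_GACubeY (parS : SiteParY 𝔸 i) (parB : BondParY 𝔸 i) (Gp : SiteOpY 𝔸 i) (U : CfgY 𝔸 i)
    (ζ : ↥(cubes i.D.toDomains) → SiteY i → ℝ) (hζ : ∀ c z, hTY i c z ≠ 0 → ζ c z = 1)
    (hinv : ∀ c : ↥(cubes i.D.toDomains), IsUnit (deltaACubeY i c parS parB U))
    (hrow : ∀ (c : ↥(cubes i.D.toDomains)) (A : FBondY i → 𝔸) (f : FBondY i), hTY i c (chartY i f.src) ≠ 0 →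
      QsCubeY i c parB U (aCubeY i c (QCubeY i c parB U A)) f = QsY i parB U (aY i (QY i parB U A)) f)
    {G : Module.End ℂ (FBondY i → 𝔸)} (hG : G * deltaAY i parS parB Gp U = 1) :
    G = (∑ c, cutMulY (hBdY i (hTY i c)) * GACubeY i c parS parB U * cutMulY (hBdY i (hTY i c)))
      + G * (∑ c, KhBY i (hTY i c) parB U * GACubeY i c parS parB U * cutMulY (hBdY i (hTY i c))
        + ∑ c, (1 - cutMulY (hBdY i (ζ c))) * DPDsY i parS Gp U *
            (cutMulY (hBdY i (hTY i c)) * GACubeY i c parS parB U * cutMulY (hBdY i (hTY i c)))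
        + ∑ c, cutMulY (hBdY i (ζ c)) * (DPDsY i parS Gp U - DPDsCubeY i c parS U) *
            (cutMulY (hBdY i (hTY i c)) * GACubeY i c parS parB U * cutMulY (hBdY i (hTY i c)))
        + ∑ c, cutMulY (hBdY i (ζ c)) * P1CubeY i c (hTY i c) parS U * GACubeY i c parS parB U * cutMulY (hBdY i (hTY i c))) :=
  fixedPoint3105_deltaAY i parS parB Gp U (hTY i) (sum_hTY_sq i) ζ hζ (fun c => GACubeY i c parS parB U) (fun c => DPDsCubeY i c parS U)
    (fun c => hloc_GACubeY i c parS parB U (hTY i c) (hinv c) (hrow c)) hG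

end Record

end Literature.MathematicalPhysics.QuantumFieldTheory.Balaban1983to89.B9Eq3105AtLetters

end
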